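import Summits.PneNP.PneNP.Theorems.LatticeMagicTargetSqueezeAssembly
import Summits.PneNP.PneNP.Theorems.LearningAssembly
import Literature.Computability.Complexity.TautMachine
import Literature.Computability.Complexity.ClayProblemProofs
import Literature.Computability.Complexity.NondeterministicProofs

/-!
# `Target` (stmt-PneNP-10709) — negative-side lemma: Krajíček's Hypothesis (ST) already proves the summit

Crux-triage (round 2, triager 1) certificate for the two round-2 cards of crux `LatticeMagic.Target`
(`Cruxes/Target/Ideas/krajicek-tpv-split-lwe-st.md`, `…/kpt-squeeze-ideal-lattice-leg.md`), which share
the lever J. Krajíček, arXiv:2506.20221, Thm 4.1 ("Problem 3.2 affirmative ⟹ ((ST) ⟹ NP ≠ coNP)"):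

* `pneNP_of_stHyp` / `pneNP_of_exists_stHyp` — Hypothesis (ST) for ANY Cook–Reckhow proof system `V`
  for `TAUT` (the tree's `STHyp V`) implies Cook's `PneNP`: `TAUT ∈ P` would give a one-round student
  (`stHyp_false_of_TAUT_mem_P`), so `TAUT ∉ P`, so `P ≠ NP` (`TAUT ∈ coNP`, `co P = P`), so `PneNP`
  (model bridges). Hence every instantiation of the (ST) leg of the squeeze — one-way permutations
  (Krajíček's Lemma 2.2), an injective one-way family (`st_of_injOWF`), a trapdoor-certified LWE pair,
  a partial-NTT map — hands Thm 4.1 a hypothesis that is itself ≥ the summit: a line through this lever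
  closes route LatticeMagic only circularly (recorded on both cards in prose; here kernel-checked once).
* `squeeze_split_given_stHyp` — the "split" form of apex B (S2 : Thm 4.1 `MEP → (ST) → NP ≠ coNP`,
  S4 : `MEP`): GIVEN the (ST) leg, S2 is implied by `Target` and S2 ∧ S4 implies `Target`, i.e. the pair
  is jointly exactly the crux relative to (ST) (cf. `squeeze_iff_NP_ne_coNP_of_injOWF`).

Refuter seat refuter-cruxtri-stmt-PneNP-10709-r2-1-0, 2026-08-16 (`Cruxes/Target/TRIAGE-r2-1.md`).
-/

set_option linter.dupNamespace false

namespace Summit.PneNP.PneNP.Theorems.Target.Negative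

open Literature.Computability.Complexity Literature.Computability.MetaComplexity
open Summit.PneNP.PneNP.Theorems.LatticeMagicTarget
open Summit.PneNP.PneNP.Theses.LatticeMagic (Target)

/-- (ST) for a complete proof system refutes `TAUT ∈ P` (contrapositive of the vacuity certificate
`stHyp_false_of_TAUT_mem_P`: under `TAUT ∈ P` a one-round student solves `DD_V`).
[cite: Krajicek2025Squeeze, §2 Hypothesis (ST)] [folklore] -/
theorem TAUT_not_mem_P_of_stHyp (V : List Bool → List Bool → Bool) (hV : IsProofSystemFor V TAUT)
    (hST : STHyp V) : TAUT ∉ Classes.P :=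
  fun hT => stHyp_false_of_TAUT_mem_P V hV hT hST

/-- (ST) for a complete proof system implies `P ≠ NP` over the tree's classes: if `P = NP` then
`coNP = co P = P ∋ TAUT`. [folklore] -/
theorem P_ne_NP_of_stHyp (V : List Bool → List Bool → Bool) (hV : IsProofSystemFor V TAUT)
    (hST : STHyp V) : Classes.P ≠ Nondeterministic.NP := by
  intro hPNP
  apply TAUT_not_mem_P_of_stHyp V hV hST
  have h1 : TAUT ∈ coNP := TAUT_mem_coNP_holds
  have h2 : coNP = Classes.P := by
    show co Nondeterministic.NP = Classes.P
    rw [← hPNP]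
    exact co_P_holds
  rw [h2] at h1
  exact h1

/-- **Hypothesis (ST) alone proves the summit.** For every Cook–Reckhow proof system `V` for `TAUT`,
`STHyp V → PneNP` (through `P ≠ NP` and the proved Cook model bridges). So the hypothesis of
Krajíček's Thm 4.1 is ≥ `PneNP` however it is supplied. [cite: Krajicek2025Squeeze, Thm 4.1] [folklore] -/
theorem pneNP_of_stHyp (V : List Bool → List Bool → Bool) (hV : IsProofSystemFor V TAUT)
    (hST : STHyp V) : _root_.PneNP :=
  Literature.Learning.pneNP_of_P_ne_NP P_bool_eq_holds NP_bool_eq_holds P_subset_NP_holds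
    (P_ne_NP_of_stHyp V hV hST)

/-- The `∃`-form handed to Thm 4.1 by any (ST) leg (one-way permutation, injective one-way family —
`st_of_injOWF` —, certified LWE pair, partial-NTT map) already proves `PneNP`. [folklore] -/
theorem pneNP_of_exists_stHyp
    (h : ∃ V : List Bool → List Bool → Bool, IsProofSystemFor V TAUT ∧ STHyp V) : _root_.PneNP := by
  obtain ⟨V, hV, hST⟩ := h
  exact pneNP_of_stHyp V hV hST

/-- The split of apex B, priced: given the (ST) leg, "Thm 4.1 (`MEP → (ST) → NP ≠ coNP`) ∧ `MEP`"
implies the crux `Target`, and Thm 4.1's implication is itself implied by `Target` — so relative to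
the (ST) leg the pair (Thm 4.1, MEP) is jointly exactly as strong as the crux. [folklore] -/
theorem squeeze_split_given_stHyp {MEP : Prop}
    (hST : ∃ V : List Bool → List Bool → Bool, IsProofSystemFor V TAUT ∧ STHyp V) :
    ((MEP → (∃ V : List Bool → List Bool → Bool, IsProofSystemFor V TAUT ∧ STHyp V) →
        Nondeterministic.NP ≠ coNP) ∧ MEP → Target) ∧
    (Target → (MEP → (∃ V : List Bool → List Bool → Bool, IsProofSystemFor V TAUT ∧ STHyp V) →
        Nondeterministic.NP ≠ coNP)) :=
  ⟨fun h => Summit.PneNP.PneNP.Theorems.latticeMagicTarget_of_NP_ne_coNP (h.1 h.2 hST),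
   fun hT _ _ => Summit.PneNP.PneNP.Theorems.NP_ne_coNP_of_latticeMagicTarget hT⟩

end Summit.PneNP.PneNP.Theorems.Target.Negative
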